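import Literature.MathematicalPhysics.QuantumFieldTheory.Balaban1983to89.B12Eq45BlockBound

/-!
# Bałaban, *Renormalization group approach to lattice gauge field theories. I* (CMP 109, 1987) [Balaban1987RG1], p. 282: the LOCALISED
# block bound «… and if one of the functions B_i is localized outside the domain X, then we have the additional exponential factor
# exp(−δ₀dist^{(ξ)}(X, supp B_i))» DERIVED for blocks of EVERY order from the first-order decay (190) [15] holding on the analyticity
# domain — so that (4.5) follows from (4.3), (4.4), (1.18), Prop. 9 and (190) of [15] with NO block hypothesis left

HONEST FRAMING (cell `lit-balaban`, verbatim): statement-level skeleton of published theorems with citation tags; proofs where landed; nothing here is a claim about the Yang–Mills mass gap.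

PDF held: `paper:balaban1987-cmp109-rg-i-small-field` (journal page = PDF page + 248); p. 282 [PDF 34] read as an image by this seat
(render `pub-balaban/b2b-balaban-ref1/pages/1987-cmp109-rg-I-small-field/…-p034-x2.png`, 2026-08-21); [15] = [Balaban1985Variational] (cell
paper B11), (190) p. 308 / Prop. 9 p. 309 as typed in `B11SectG` / `B11Eq174Chart` / `B11Eq183Differentiation` (r08).

WHAT IS REPRODUCED: SKELETON rows **B12.Eq4.2-4.3** / **B12.Eq4.5** (display owner r09, fold owner r20; referee ref-5), the p. 282 sentence
(verbatim in the header of `…B12Eq45BlockBound`): *«… The derivative has an exponential decay in a length of a shortest tree graph of this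
type. The norm in (4.4) of the expression ⟨δ^{n(p)}/δB^{n(p)} 𝐇_j(□₀, 0), ⊗_{i∈N(p)} B_i⟩ can be estimated by B₃ Π_{i∈N(p)} |B_i|, and if
one of the functions B_i is localized outside the domain X, then we have the additional exponential factor exp(−δ₀dist^{(ξ)}(X, supp B_i)).»*
— its SECOND (localised) half = the hypothesis `hvloc` of pv12's (4.3) ⇒ (4.5) kernel `B12Repr43.norm_iteratedFDeriv_comp_le`, the LAST block
hypothesis left after `B12Eq45BlockBound` (p05 g8: `hv`, `hH`, `hH0` discharged).  Print derives it from the Sect. G [15] tree-graph expansion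
of the higher derivatives.  THIS FILE derives it, for blocks of every order `n(p) ≥ 1`, from the FIRST-ORDER statement only — the (190)-type
bound *«|(δ/δB(c))𝓗(B, b)| ≤ … exp(−δ₀d(b,c))»* read in the norm of (4.4) on `X` for an argument `B_i` supported outside `X`,
`‖⟨δ𝓗(B)/δB, B_i⟩‖_X ≤ W₀·K·|B_i|`, `W₀ = exp(−δ₀dist^{(ξ)}(X, supp B_i))`, holding at EVERY `B` of the analyticity ball (as [15] proves it:
(190) is a bound on the functional derivative of the nonlinear 𝓗 at an arbitrary admissible `B`) — plus Prop. 9's analyticity: move the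
outside argument `B_i` to the last slot of `⟨δ^{n(p)}𝓗(0), ⊗B⟩` by the symmetry of the derivative, read `Dᵐ⁺¹𝓗(0)[u, B_i] = Dᵐ(B ↦ D𝓗(B)[B_i])(0)[u]`,
and Cauchy-estimate the analytic map `B ↦ D𝓗(B)[B_i]`, bounded by `W₀K|B_i|` on the ball.

WHAT IS CERTIFIED (kernel, sorry-free; axioms standard; theorems only — no definition, no new named fact), in pv12's abstract setting
`H : W → E` (`E` complete) and then for [15]'s chart:
* `iteratedFDeriv_snoc_apply` — `Dᵐ⁺¹H(x)[u_1, …, u_m, w] = Dᵐ(y ↦ DH(y)[w])(x)[u_1, …, u_m]` (Mathlib `iteratedFDeriv_succ_apply_right` +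
  `ContinuousLinearMap.iteratedFDeriv_comp_left`); `pow_le_max_pow` (`(2m/a)ᵐ ≤ max{1,2n/a}ⁿ` for `m ≤ n`).
* **`norm_iteratedFDeriv_le_of_loc`** — THE MECHANISM: `H` analytic on an open `U_W ⊇ {‖B‖ < a}`, one argument `v_{q₀}` with the uniform
  first-order bound `‖DH(y)[v_{q₀}]‖ ≤ C‖v_{q₀}‖` for all `‖y‖ < a` ⇒ `‖Dᵐ⁺¹H(0)[v_0,…,v_m]‖ ≤ C (2m/a)ᵐ Π_r ‖v_r‖` (symmetry
  `ContDiffAt.iteratedFDeriv_comp_perm` with the transposition `(last q₀)`, then pv12's iterated Cauchy estimate `B12Repr43.norm_iteratedFDeriv_apply_le_of_ball`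
  on `y ↦ DH(y)[v_{q₀}]`).
* **`norm_blockIns_le_localised`** — THE LOCALISED HALF OF THE p. 282 SENTENCE: if the block `N(p)` contains an argument `B_i` localised outside
  `X` (`out i`) and (190) holds in the shape `‖DH(y)[B_i]‖ ≤ W₀·K·‖B_i‖` on the ball, then `‖⟨δ^{n(p)}H(0), ⊗_{i∈N(p)}B_i⟩‖ ≤ W₀·(K·max{1,2n/a}ⁿ)·Π‖B_i‖`
  — pv12's `hvloc` with `B₃ := K·max{1,2n/a}ⁿ`.
* **`norm_iteratedFDeriv_comp_le_of_loc`** — (4.5) WITH EVERY BLOCK HYPOTHESIS DISCHARGED: outer `f` analytic on `U ⊇ {‖𝐇‖ < α₂}` with sup `S`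
  ((4.4) + (1.18)); inner `H` analytic on `U_W ⊇ {‖B‖ < a}` with sup `S_H`, `H 0 = 0` (Prop. 9 [15], (3.27)); the first-order localised bound for the
  outside arguments ((190) [15]); `B₃ := max{S_H, K}·max{1,2n/a}ⁿ`, `2B₃ ≥ α₂` ⇒ `‖Dⁿ(f∘H)(0)[B_1,…,B_n]‖ ≤ (2n²B₃/α₂)ⁿ·S·W₀·Π_i‖B_i‖`.
* **`norm_iteratedFDeriv_comp_chartH179_le_of_loc`** — the same with the inner map = [15]'s chart (179) `B11Eq183Differentiation.chartH179`
  (`B12Eq45BlockBound` §2: `hH`, `hH0`, sup `K_T(ε₄+a)`), the (190)-shape bound on `D𝓗(y)[B_i]` for the outside arguments as the one remaining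
  by-reference input.
MODELLING / HONEST SCOPE.  (M1) As in `B12Repr43`/`B12Eq45BlockBound`: «the norm in (4.4) … on X» and `|B_i|` are the norms of abstract complex
normed spaces (DIVERGENCE D-pv12.3/6); the (190) input is taken in the shape pv12 already used for `n(p) = 1`
(`B12Ineq45.loc_dH_le_of_ineq190_localised`), now at every point of the analyticity ball.  (M2) The constant is a Cauchy constant, not print's
tree-graph constant; only ONE localisation factor `W₀` is kept (exactly what (4.5) uses, `B12Ineq45.prod_weights_le_single`).  (M3) No lattice
object, no (190) derivation (rows B11.Eq190 / B11.SectG).  Mega-formalization `lit-balaban`, HOME `run/shared/lean/pub/lit-balaban/`, Phase-2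
proof seat p05 gen 8 (unit `lit-balaban-p05`).  Imports `…B12Eq45BlockBound` (p05 g8) only; modifies nothing there.
-/

noncomputable section

open Set Metric Filter Finset Complex MeasureTheory
open scoped Topology BigOperators

namespace Literature.MathematicalPhysics.QuantumFieldTheory.Balaban1983to89.B12Eq45LocalisedBlocks

open Literature.MathematicalPhysics.QuantumFieldTheory.Balaban1983to89
open B12Ineq45 B12Repr43 B12Eq43ContourFormula B12Eq45BlockBound B11Prop6Scheme B11Eq174Chart B11Eq183Differentiation

/-! ## §1. Higher derivatives with one localised argument, from the first-order bound and analyticity -/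

section Generic

variable {W : Type*} [NormedAddCommGroup W] [NormedSpace ℂ W]
  {E : Type*} [NormedAddCommGroup E] [NormedSpace ℂ E]
  {F : Type*} [NormedAddCommGroup F] [NormedSpace ℂ F]

/-- The last argument of `Dᵐ⁺¹H(x)` goes into a first derivative: `Dᵐ⁺¹H(x)[u_1, …, u_m, w] = Dᵐ(y ↦ DH(y)[w])(x)[u_1, …, u_m]` for `H`
of class `Cᵐ⁺¹` at `x` (Mathlib `iteratedFDeriv_succ_apply_right` followed by `ContinuousLinearMap.iteratedFDeriv_comp_left` for the evaluation
at `w`). [cite: Balaban1987RG1, (4.3) p.281] -/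
theorem iteratedFDeriv_snoc_apply {H : W → E} {x : W} {m : ℕ} (hH : ContDiffAt ℂ ((m + 1 : ℕ) : WithTop ℕ∞) H x) (w : W)
    (u : Fin m → W) :
    iteratedFDeriv ℂ (m + 1) H x (Fin.snoc u w) = iteratedFDeriv ℂ m (fun y => fderiv ℂ H y w) x u := by
  rw [iteratedFDeriv_succ_apply_right]
  simp only [Fin.init_snoc, Fin.snoc_last]
  have hf1 : ContDiffAt ℂ (m : WithTop ℕ∞) (fun y => fderiv ℂ H y) x := hH.fderiv_right (by norm_cast)
  have hcomp := ContinuousLinearMap.iteratedFDeriv_comp_left (ContinuousLinearMap.apply ℂ E w)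
    (f := fun y => fderiv ℂ H y) hf1 (i := m) le_rfl
  have hfun : (fun y => fderiv ℂ H y w) = (ContinuousLinearMap.apply ℂ E w) ∘ fun y => fderiv ℂ H y := rfl
  rw [hfun, hcomp]
  rfl

/-- `(2m/a)ᵐ ≤ max{1, 2n/a}ⁿ` for `m ≤ n` (one Cauchy constant for all block sizes). [cite: Balaban1987RG1, p.282] -/
theorem pow_le_max_pow {a : ℝ} (ha : 0 < a) {m n : ℕ} (hm : m ≤ n) :
    (2 * (m : ℝ) / a) ^ m ≤ (max 1 (2 * (n : ℝ) / a)) ^ n := by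
  have hmr : (m : ℝ) ≤ n := by exact_mod_cast hm
  calc (2 * (m : ℝ) / a) ^ m ≤ (max 1 (2 * (n : ℝ) / a)) ^ m := by
        refine pow_le_pow_left₀ (by positivity) ((le_max_right _ _).trans' ?_) _
        exact div_le_div_of_nonneg_right (by linarith) ha.le
    _ ≤ (max 1 (2 * (n : ℝ) / a)) ^ n := pow_le_pow_right₀ (le_max_left _ _) hm

variable [CompleteSpace E]

/-- **THE MECHANISM: a higher derivative with one «outside» argument, from the FIRST-ORDER bound on the analyticity ball.**  `H` analytic on an
open `U_W ⊇ {‖y‖ < a}`; for the argument `v_{q₀}` the derivative `y ↦ DH(y)[v_{q₀}]` is bounded by `C‖v_{q₀}‖` on the ball (the (190)-shape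
bound at every admissible background).  Then `‖Dᵐ⁺¹H(0)[v_0, …, v_m]‖ ≤ C·(2m/a)ᵐ·Π_r ‖v_r‖`: by the symmetry of `Dᵐ⁺¹H(0)` the argument
`v_{q₀}` may be taken last, `Dᵐ⁺¹H(0)[…, v_{q₀}] = Dᵐ(y ↦ DH(y)[v_{q₀}])(0)[…]` (`iteratedFDeriv_snoc_apply`), and the analytic map
`y ↦ DH(y)[v_{q₀}]` obeys pv12's iterated Cauchy estimate `B12Repr43.norm_iteratedFDeriv_apply_le_of_ball`. [cite: Balaban1987RG1, p.282] -/
theorem norm_iteratedFDeriv_le_of_loc {UW : Set W} (hUW : IsOpen UW) {a : ℝ} (ha : 0 < a) (hball : ball (0 : W) a ⊆ UW)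
    {H : W → E} (hH : AnalyticOnNhd ℂ H UW) {m : ℕ} (v : Fin (m + 1) → W) (q₀ : Fin (m + 1)) {C : ℝ}
    (hloc : ∀ y ∈ ball (0 : W) a, ‖fderiv ℂ H y (v q₀)‖ ≤ C * ‖v q₀‖) :
    ‖iteratedFDeriv ℂ (m + 1) H 0 v‖ ≤ C * (2 * (m : ℝ) / a) ^ m * ∏ r, ‖v r‖ := by
  set σ : Equiv.Perm (Fin (m + 1)) := Equiv.swap (Fin.last m) q₀ with hσ
  have h0U : (0 : W) ∈ UW := hball (mem_ball_self ha)
  have hsymm : iteratedFDeriv ℂ (m + 1) H 0 v = iteratedFDeriv ℂ (m + 1) H 0 (v ∘ ⇑σ) :=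
    ((hH 0 h0U).contDiffAt.iteratedFDeriv_comp_perm v σ).symm
  have hσl : (v ∘ ⇑σ) (Fin.last m) = v q₀ := by
    simp [hσ, Equiv.swap_apply_left]
  have hsnoc : v ∘ ⇑σ = Fin.snoc (Fin.init (v ∘ ⇑σ)) (v q₀) := by
    rw [← hσl, Fin.snoc_init_self]
  have hG : AnalyticOnNhd ℂ (fun y => fderiv ℂ H y (v q₀)) UW := fun y hy =>
    ((ContinuousLinearMap.apply ℂ E (v q₀)).analyticAt _).comp (hH.fderiv y hy)
  rw [hsymm, hsnoc, iteratedFDeriv_snoc_apply ((hH 0 h0U).contDiffAt) (v q₀) (Fin.init (v ∘ ⇑σ))]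
  have key := norm_iteratedFDeriv_apply_le_of_ball hUW ha hball hG hloc (Fin.init (v ∘ ⇑σ))
    (fun r => ‖Fin.init (v ∘ ⇑σ) r‖) (fun _ => norm_nonneg _) fun _ => le_rfl
  refine key.trans (le_of_eq ?_)
  -- `(Π_r ‖(v∘σ)(castSucc r)‖) · ‖v q₀‖ = Π_r ‖(v∘σ) r‖ = Π_r ‖v r‖`
  have hprod : (∏ r : Fin m, ‖Fin.init (v ∘ ⇑σ) r‖) * ‖v q₀‖ = ∏ r, ‖v r‖ := by
    rw [← hσl, show (∏ r : Fin m, ‖Fin.init (v ∘ ⇑σ) r‖) = ∏ r : Fin m, ‖(v ∘ ⇑σ) (Fin.castSucc r)‖ from rfl,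
      ← Fin.prod_univ_castSucc (fun r => ‖(v ∘ ⇑σ) r‖)]
    exact Equiv.prod_comp σ (fun r => ‖v r‖)
  rw [← hprod]
  ring

variable {n : ℕ}

/-- **THE LOCALISED HALF OF THE p. 282 SENTENCE, from (190) + analyticity**: for a block `N(p)` of a partition of `{1,…,n}` containing an
argument `B_i` localised outside `X` (`out i`), the (190)-shape bound `‖DH(y)[B_i]‖ ≤ W₀·K·‖B_i‖` at every `‖y‖ < a`
(`W₀ = exp(−δ₀dist^{(ξ)}(X, supp B_i))`) and the analyticity of `H` on `U_W ⊇ {‖y‖ < a}` give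
`‖⟨δ^{n(p)}H(0), ⊗_{i∈N(p)}B_i⟩‖ ≤ W₀·(K·max{1,2n/a}ⁿ)·Π_{i∈N(p)}‖B_i‖` — the hypothesis `hvloc` of `B12Repr43.norm_iteratedFDeriv_comp_le`.
[cite: Balaban1987RG1, p.282] -/
theorem norm_blockIns_le_localised {UW : Set W} (hUW : IsOpen UW) {a : ℝ} (ha : 0 < a) (hball : ball (0 : W) a ⊆ UW)
    {H : W → E} (hH : AnalyticOnNhd ℂ H UW) (B : Fin n → W) (out : Fin n → Prop) {W₀ K : ℝ} (hW0 : 0 ≤ W₀) (hK : 0 ≤ K)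
    (hloc : ∀ i, out i → ∀ y ∈ ball (0 : W) a, ‖fderiv ℂ H y (B i)‖ ≤ W₀ * (K * ‖B i‖))
    (c : OrderedFinpartition n) (p : Fin c.length) (hp : ∃ q, out (c.emb p q)) :
    ‖blockIns (𝕜 := ℂ) H 0 B c p‖ ≤ W₀ * ((K * (max 1 (2 * (n : ℝ) / a)) ^ n) * ∏ q, ‖B (c.emb p q)‖) := by
  obtain ⟨q₀, hq₀⟩ := hp
  -- generic statement over the block size `k = m + 1 ≤ n`
  have main : ∀ (k : ℕ), 0 < k → k ≤ n → ∀ (v : Fin k → W) (q : Fin k),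
      (∀ y ∈ ball (0 : W) a, ‖fderiv ℂ H y (v q)‖ ≤ W₀ * (K * ‖v q‖)) →
        ‖iteratedFDeriv ℂ k H 0 v‖ ≤ W₀ * ((K * (max 1 (2 * (n : ℝ) / a)) ^ n) * ∏ r, ‖v r‖) := by
    intro k hk hkn v q hv
    obtain ⟨m, rfl⟩ := Nat.exists_eq_succ_of_ne_zero hk.ne'
    have h := norm_iteratedFDeriv_le_of_loc hUW ha hball hH v q (C := W₀ * K)
      (fun y hy => by rw [mul_assoc]; exact hv y hy)
    have hWK : 0 ≤ W₀ * K := mul_nonneg hW0 hK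
    refine h.trans ?_
    have hpow : (2 * (m : ℝ) / a) ^ m ≤ (max 1 (2 * (n : ℝ) / a)) ^ n := pow_le_max_pow ha (by omega)
    have hP : 0 ≤ ∏ r, ‖v r‖ := Finset.prod_nonneg fun _ _ => norm_nonneg _
    calc W₀ * K * (2 * (m : ℝ) / a) ^ m * ∏ r, ‖v r‖ ≤ W₀ * K * (max 1 (2 * (n : ℝ) / a)) ^ n * ∏ r, ‖v r‖ := by
          gcongr
      _ = W₀ * ((K * (max 1 (2 * (n : ℝ) / a)) ^ n) * ∏ r, ‖v r‖) := by ring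
  exact main (c.partSize p) (c.partSize_pos p) (c.partSize_le p) (B ∘ c.emb p) q₀ (hloc _ hq₀)

variable [CompleteSpace F]

/-- **(4.5) WITH EVERY BLOCK HYPOTHESIS DISCHARGED** (pv12's `B12Repr43.norm_iteratedFDeriv_comp_le` with `hH`, `hv`, `hvloc` supplied): outer
`f` (`𝐇 ↦ 𝐄^{(j)}(X, exp iξ𝐇)`) analytic on an open `U ⊇ {‖𝐇‖ < α₂}` with `‖f‖ ≤ S` there ((4.4), (1.18)); inner `H` (`B ↦ 𝐇_j(□₀,B)`) analytic
on an open `U_W ⊇ {‖B‖ < a}` with `‖H‖ ≤ S_H` there and `H(0) = 0` (Prop. 9 [15], (3.27)); the first-order localised bound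
`‖DH(y)[B_i]‖ ≤ W₀·K·‖B_i‖` on the ball for every argument `B_i` localised outside `X` ((190) [15]), `W₀ ∈ [0,1]`, at least one such argument;
`B₃ := max{S_H, K}·max{1, 2n/a}ⁿ`, `2B₃ ≥ α₂` ⇒ `‖Dⁿ(f∘H)(0)[B_1,…,B_n]‖ ≤ (2n²B₃/α₂)ⁿ·S·W₀·Π_i‖B_i‖`.
[cite: Balaban1987RG1, (4.3)–(4.5) pp.281–282] -/
theorem norm_iteratedFDeriv_comp_le_of_loc {U : Set E} (hU : IsOpen U) {α₂ S : ℝ} (hα : 0 < α₂)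
    (hballE : ball (0 : E) α₂ ⊆ U) {f : E → F} (hf : AnalyticOnNhd ℂ f U) (hS : ∀ y ∈ ball (0 : E) α₂, ‖f y‖ ≤ S)
    {UW : Set W} (hUW : IsOpen UW) {a SH : ℝ} (ha : 0 < a) (hball : ball (0 : W) a ⊆ UW)
    {H : W → E} (hH : AnalyticOnNhd ℂ H UW) (hSH : ∀ y ∈ ball (0 : W) a, ‖H y‖ ≤ SH) (hH0 : H 0 = 0)
    (B : Fin n → W) {W₀ K : ℝ} (hW0 : 0 ≤ W₀) (hW1 : W₀ ≤ 1) (hK : 0 ≤ K) (out : Fin n → Prop) (i₀ : Fin n) (hi₀ : out i₀)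
    (hloc : ∀ i, out i → ∀ y ∈ ball (0 : W) a, ‖fderiv ℂ H y (B i)‖ ≤ W₀ * (K * ‖B i‖))
    (hB : α₂ ≤ 2 * (max SH K * (max 1 (2 * (n : ℝ) / a)) ^ n)) :
    ‖iteratedFDeriv ℂ n (f ∘ H) 0 B‖ ≤
      (2 * (n : ℝ) ^ 2 * (max SH K * (max 1 (2 * (n : ℝ) / a)) ^ n) / α₂) ^ n * S * W₀ * ∏ i, ‖B i‖ := by
  have hM : 0 ≤ (max 1 (2 * (n : ℝ) / a)) ^ n := pow_nonneg (zero_le_one.trans (le_max_left _ _)) _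
  have hv : ∀ (c : OrderedFinpartition n) (p : Fin c.length),
      ‖blockIns (𝕜 := ℂ) H 0 B c p‖ ≤ (max SH K * (max 1 (2 * (n : ℝ) / a)) ^ n) * ∏ q, ‖B (c.emb p q)‖ := fun c p => by
    refine (norm_blockIns_le_uniform hUW ha hball hH hSH B c p).trans ?_
    have hP : 0 ≤ ∏ q, ‖B (c.emb p q)‖ := Finset.prod_nonneg fun _ _ => norm_nonneg _
    exact mul_le_mul_of_nonneg_right (mul_le_mul_of_nonneg_right (le_max_left _ _) hM) hP
  have hvloc : ∀ (c : OrderedFinpartition n) (p : Fin c.length), (∃ q, out (c.emb p q)) →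
      ‖blockIns (𝕜 := ℂ) H 0 B c p‖ ≤ W₀ * ((max SH K * (max 1 (2 * (n : ℝ) / a)) ^ n) * ∏ q, ‖B (c.emb p q)‖) :=
    fun c p hp => by
    refine (norm_blockIns_le_localised hUW ha hball hH B out hW0 hK hloc c p hp).trans ?_
    have hP : 0 ≤ ∏ q, ‖B (c.emb p q)‖ := Finset.prod_nonneg fun _ _ => norm_nonneg _
    exact mul_le_mul_of_nonneg_left
      (mul_le_mul_of_nonneg_right (mul_le_mul_of_nonneg_right (le_max_right _ _) hM) hP) hW0
  exact norm_iteratedFDeriv_comp_le hU hα hballE hf hS hB hW0 hW1 ((hH 0 (hball (mem_ball_self ha))).contDiffAt) hH0 B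
    out i₀ hi₀ hv hvloc

end Generic

/-! ## §2. The inner map = [15]'s chart (179): (4.5) from (4.4), (1.18), Prop. 9 and (190) -/

section Chart

variable {𝒳 𝒴 𝒵 : Type*} [NormedAddCommGroup 𝒳] [NormedSpace ℂ 𝒳] [NormedAddCommGroup 𝒴] [NormedSpace ℂ 𝒴]
  [NormedAddCommGroup 𝒵] [NormedSpace ℂ 𝒵] [CompleteSpace 𝒳] [CompleteSpace 𝒴] [CompleteSpace 𝒵]
  {𝒢 : 𝒵 →L[ℂ] 𝒴} {W : 𝒴 → 𝒵} {D2 : 𝒴 →L[ℂ] 𝒵} {H₀ : 𝒳 →L[ℂ] 𝒴} {B₀ θ C₄ a₃ j a ε₄ : ℝ}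
  {F : Type*} [NormedAddCommGroup F] [NormedSpace ℂ F] [CompleteSpace F]

/-- **(4.5) with the inner map = [15]'s chart (179) and EVERY block hypothesis discharged**: the data of `B12Eq45BlockBound` §2 (a
`B11Eq174Chart.Regime`, Prop. 4's analyticity letter `hWa`, `Tm` analytic and `K_T`-Lipschitz on `{‖Y‖ < ε₄ + a}` with `Tm 0 = 0`, a radius
`r` with `‖B‖ < r ⇒ ‖H₀B‖ < a ∧ ‖Δ⁽²⁾H₀B‖ < j`), the outer data ((4.4) analyticity of `f` on `U ⊇ {‖𝐇‖ < α₂}`, (1.18) sup `S`), and the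
(190)-shape first-order bound `‖D𝓗(y)[B_i]‖ ≤ W₀·K·‖B_i‖` on `{‖y‖ < r}` for the arguments localised outside `X`;
`B₃ := max{K_T(ε₄+a), K}·max{1,2n/r}ⁿ`, `2B₃ ≥ α₂` ⇒ `‖Dⁿ(f∘𝓗)(0)[B_1,…,B_n]‖ ≤ (2n²B₃/α₂)ⁿ·S·W₀·Π_i‖B_i‖`.
[cite: Balaban1987RG1, (4.3)–(4.5) pp.281–282] -/
theorem norm_iteratedFDeriv_comp_chartH179_le_of_loc (R : Regime 𝒢 0 W B₀ θ C₄ a₃ j a ε₄)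
    (hWa : AnalyticOnNhd ℂ W {Y : 𝒴 | ‖Y‖ < a₃}) {Tm : 𝒴 → 𝒴} (hTm : AnalyticOnNhd ℂ Tm {Y : 𝒴 | ‖Y‖ < ε₄ + a}) {KT : ℝ}
    (hKT : 0 ≤ KT) (hT0 : Tm 0 = 0) (hT : ∀ x y : 𝒴, ‖x‖ < ε₄ + a → ‖y‖ < ε₄ + a → ‖Tm x - Tm y‖ ≤ KT * ‖x - y‖)
    {r : ℝ} (hr : 0 < r) (hdom : ∀ B : 𝒳, ‖B‖ < r → ‖H₀ B‖ < a ∧ ‖D2 (H₀ B)‖ < j) (hj : 0 < j) (ha : 0 < a)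
    {U : Set 𝒴} (hU : IsOpen U) {α₂ S : ℝ} (hα : 0 < α₂) (hballU : ball (0 : 𝒴) α₂ ⊆ U) {f : 𝒴 → F}
    (hf : AnalyticOnNhd ℂ f U) (hS : ∀ y ∈ ball (0 : 𝒴) α₂, ‖f y‖ ≤ S)
    {n : ℕ} (B : Fin n → 𝒳) {W₀ K : ℝ} (hW0 : 0 ≤ W₀) (hW1 : W₀ ≤ 1) (hK : 0 ≤ K) (out : Fin n → Prop) (i₀ : Fin n)
    (hi₀ : out i₀)
    (hloc : ∀ i, out i → ∀ y ∈ ball (0 : 𝒳) r, ‖fderiv ℂ (chartH179 𝒢 W D2 H₀ Tm ε₄) y (B i)‖ ≤ W₀ * (K * ‖B i‖))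
    (hB : α₂ ≤ 2 * (max (KT * (ε₄ + a)) K * (max 1 (2 * (n : ℝ) / r)) ^ n)) :
    ‖iteratedFDeriv ℂ n (f ∘ chartH179 𝒢 W D2 H₀ Tm ε₄) 0 B‖ ≤
      (2 * (n : ℝ) ^ 2 * (max (KT * (ε₄ + a)) K * (max 1 (2 * (n : ℝ) / r)) ^ n) / α₂) ^ n * S * W₀ * ∏ i, ‖B i‖ :=
  norm_iteratedFDeriv_comp_le_of_loc hU hα hballU hf hS (isOpen_dom180 (H₀ := H₀) (a := a) (D2 := D2) (j := j)) hr
    (fun B hB => hdom B (mem_ball_zero_iff.1 hB)) (analyticOnNhd_chartH179 R hWa hTm)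
    (fun B hB => norm_chartH179_le R hKT hT0 hT (hdom B (mem_ball_zero_iff.1 hB)).1 (hdom B (mem_ball_zero_iff.1 hB)).2.le)
    (chartH179_zero R hj.le ha hT0) B hW0 hW1 hK out i₀ hi₀ hloc hB

end Chart

end Literature.MathematicalPhysics.QuantumFieldTheory.Balaban1983to89.B12Eq45LocalisedBlocks

end
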